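import Summits.BirchSwinnertonDyer.BirchSwinnertonDyer.Theorems.KolyvaginRoadThreeSchneiderTamAtThreeHeightLogNumeratorSecondOrderSeries
import Summits.BirchSwinnertonDyer.BirchSwinnertonDyer.Theorems.ClassRecordThreeRegCertKernelO3FormalLog
import Literature.NumberTheory.EllipticCurves.PadicSigmaLogFirstOrderProofs
import HarnessLib

/-!
# Crux `SchneiderTamAtThree` (item 19154) — THE HEIGHT IS THE LOGARITHM OF THE NUMERATOR, DEEP POINTS,
# part 1/4: the equation and the formal logarithm to FOURTH order, the Iwasawa logarithm to SECOND order,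
# and the uniformisation scale to the depth of the Tate parameter

HONEST FRAMING (cell `bsd-stepL`, seat `bsd-stepL-tam3-p2` g2, WIDTH-LEVER second lane «closed-form Schneider
local factor at 3 … finite case table proved once»; `--supports stmt-BirchSwinnertonDyer-19154 --as helper`):
THEOREMS ONLY, unconditional, route-independent (no Theses import); 0 definitions, 0 named facts, 0 sorry;
nothing here proves the crux `SchneiderTamAtThree`, Schneider's conjecture or BSD. Bookkeeping lemmas for the
DEEP-POINT numerator law (part 3, `…Deep.lean`): for a rational point of level `k = v₃(z(P)) ≥ 2`,
`ĥ₃(P) ≡ log₃ num x + ((b₂b₄ − 18b₆)/c₄)·den x/num x (mod 3^{2k + min(2k, ν)})`, `3^ν ‖ q`.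

* §1 `norm_pow_three_div_sq_sub_quartic_le` — `x z² = 1 − a₁z − a₂z² − a₃z³ + O(z⁴)` (`‖O‖ ≤ ‖x‖⁻²`).
* §2 `norm_padicFormalLog_sub_quartic_le_pow_five` — `log_W z = z + ½a₁z² + ⅓(a₁²+a₂)z³ +
  ¼(a₁³+2a₁a₂+2a₃)z⁴ + O(‖z‖⁵)` on `‖z‖₃ ≤ 3⁻¹` (relative form of lane A's
  `KernelCert.norm_padicFormalLog_sub_quartic_le`).
* §3 `norm_padicLog_one_add_sub_sub_le` — `‖log₃(1+u) − (u − u²/2)‖₃ ≤ 3‖u‖₃³` for `‖u‖₃ ≤ 3⁻¹`.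
* §4 `norm_inv_scaleSq_add_c₆_div_c₄_le` — **`‖C⁻² + c₆/c₄‖₃ ≤ 3⁻¹‖q‖₃`**: the uniformisation scale is the
  rational `−c₆/c₄` to the depth of `q` and one digit more (`c₄(E_q) + c₆(E_q) = 240s₃(q) + 504s₅(q)`); with
  `ν = v₃(q) = v₃(Δ)` this is the Kodaira-type precision of the «closed form»: `κ = (C⁻² − b₂)/12 ≡
  (18b₆ − b₂b₄)/c₄ (mod 3^ν)` (`norm_kappa_sub_rational_le`).

References: [SteinWuthrich2013] §4.2; [SilvermanAEC2009] IV.1, IV.6, VII.2; [SilvermanATAEC1994] V.3.1;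
[Iwasawa1972PadicL] §4.4; tree: parts 1–3 of the second-order chain, lane A `…RegCertKernelO3FormalLog`.
-/

noncomputable section

open scoped Classical Nat
open Filter Topology IsUltrametricDist PowerSeries
open WeierstrassCurve Literature.NumberTheory.EllipticCurves
open Literature.NumberTheory.EllipticCurves.SteinWuthrich2013
open Literature.NumberTheory.EllipticCurves.TateCurve
open Literature.NumberTheory.EllipticCurves.Rank1Residual
open Summit.BirchSwinnertonDyer.Uniform.UI.O2

namespace Summit.BirchSwinnertonDyer.Rank1Residual.X11b.RegMult.HeightLogNumerator

/-! ### §1 The equation to fourth order: `x z² = 1 − a₁z − a₂z² − a₃z³ + O(‖x‖⁻²)` on `E₁` -/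

/-- **`‖x³/y² − 1 − a₁·x/y + a₂·x²/y² − a₃·x³/y³‖ ≤ ‖x‖⁻²` for a point `(x, y)` with `‖x‖ > 1` of a
`3`-integral Weierstrass equation**: multiplying the equation by `y`,
`x³y − y³ − a₁xy² + a₂x²y − a₃x³ = a₃(y² − x³) − a₄xy − a₆y = a₃(a₂x² + a₄x + a₆ − a₁xy − a₃y) − a₄xy − a₆y`,
each term of norm `≤ ‖x‖‖y‖ = ‖y‖³‖x‖⁻²`. In the parameter `z = −x/y`:
`x z² = 1 − a₁z − a₂z² − a₃z³ + O(z⁴)`. [cite: SilvermanAEC2009, IV.1 and VII.2.2] -/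
theorem norm_pow_three_div_sq_sub_quartic_le {V : WeierstrassCurve ℚ_[3]} [V.IsIntegral ℤ_[3]] {x y : ℚ_[3]}
    (heq : V.toAffine.Equation x y) (hx : 1 < ‖x‖) :
    ‖x ^ 3 / y ^ 2 - 1 - V.a₁ * (x / y) + V.a₂ * (x / y) ^ 2 - V.a₃ * (x / y) ^ 3‖ ≤ ‖x‖⁻¹ ^ 2 := by
  obtain ⟨h₁, h₂, h₃, h₄, h₆⟩ := V.norm_coeffs_le_one
  obtain ⟨hsq, hxy⟩ := V.norm_sq_eq_norm_cube heq hx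
  rw [Affine.equation_iff] at heq
  have hx0 : 0 < ‖x‖ := one_pos.trans hx
  have hy1 : 1 < ‖y‖ := hx.trans hxy
  have hy0 : 0 < ‖y‖ := one_pos.trans hy1
  have hy0' : y ≠ 0 := norm_pos_iff.mp hy0
  have hy3 : y ^ 3 ≠ 0 := pow_ne_zero 3 hy0'
  have hnum : x ^ 3 * y - y ^ 3 - V.a₁ * x * y ^ 2 + V.a₂ * x ^ 2 * y - V.a₃ * x ^ 3 =
      V.a₃ * (V.a₂ * x ^ 2 + V.a₄ * x + V.a₆ - V.a₁ * x * y - V.a₃ * y) - V.a₄ * x * y - V.a₆ * y := by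
    linear_combination (V.a₃ - y) * heq
  have e : x ^ 3 / y ^ 2 - 1 - V.a₁ * (x / y) + V.a₂ * (x / y) ^ 2 - V.a₃ * (x / y) ^ 3 =
      (V.a₃ * (V.a₂ * x ^ 2 + V.a₄ * x + V.a₆ - V.a₁ * x * y - V.a₃ * y) - V.a₄ * x * y - V.a₆ * y) / y ^ 3 := by
    rw [← hnum, eq_div_iff hy3]
    field_simp
  rw [e, norm_div, norm_pow, div_le_iff₀ (pow_pos hy0 3)]
  -- `‖x‖⁻² · ‖y‖³ = ‖x‖‖y‖` since `‖y‖² = ‖x‖³`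
  have hrhs : ‖x‖⁻¹ ^ 2 * ‖y‖ ^ 3 = ‖x‖ * ‖y‖ := by
    have : ‖y‖ ^ 3 = ‖x‖ ^ 3 * ‖y‖ := by rw [← hsq]; ring
    rw [this]; field_simp
  rw [hrhs]
  have hx1 : 1 ≤ ‖x‖ := hx.le
  have hy1' : 1 ≤ ‖y‖ := hy1.le
  have hxy' : ‖x‖ ≤ ‖y‖ := hxy.le
  have hxxy : ‖x‖ * ‖x‖ ≤ ‖x‖ * ‖y‖ := by gcongr
  have hyxy : ‖y‖ ≤ ‖x‖ * ‖y‖ := le_mul_of_one_le_left hy0.le hx1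
  have hxle : ‖x‖ ≤ ‖x‖ * ‖y‖ := le_mul_of_one_le_right hx0.le hy1'
  have h1le : (1 : ℝ) ≤ ‖x‖ * ‖y‖ := one_le_mul_of_one_le_of_one_le hx1 hy1'
  have hin : ‖V.a₂ * x ^ 2 + V.a₄ * x + V.a₆ - V.a₁ * x * y - V.a₃ * y‖ ≤ ‖x‖ * ‖y‖ := by
    refine (norm_sub_le_max₃ _ _).trans (max_le ((norm_sub_le_max₃ _ _).trans (max_le
      ((norm_add_le_max _ _).trans (max_le ((norm_add_le_max _ _).trans (max_le ?_ ?_)) ?_)) ?_)) ?_)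
    · rw [norm_mul, norm_pow]
      calc ‖V.a₂‖ * ‖x‖ ^ 2 ≤ 1 * ‖x‖ ^ 2 := by gcongr
        _ = ‖x‖ * ‖x‖ := by ring
        _ ≤ ‖x‖ * ‖y‖ := hxxy
    · rw [norm_mul]
      calc ‖V.a₄‖ * ‖x‖ ≤ 1 * ‖x‖ := by gcongr
        _ = ‖x‖ := one_mul _
        _ ≤ ‖x‖ * ‖y‖ := hxle
    · exact h₆.trans h1le
    · rw [norm_mul, norm_mul]
      calc ‖V.a₁‖ * ‖x‖ * ‖y‖ ≤ 1 * ‖x‖ * ‖y‖ := by gcongr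
        _ = ‖x‖ * ‖y‖ := by ring
    · rw [norm_mul]
      calc ‖V.a₃‖ * ‖y‖ ≤ 1 * ‖y‖ := by gcongr
        _ = ‖y‖ := one_mul _
        _ ≤ ‖x‖ * ‖y‖ := hyxy
  refine (norm_sub_le_max₃ _ _).trans (max_le ((norm_sub_le_max₃ _ _).trans (max_le ?_ ?_)) ?_)
  · rw [norm_mul]
    calc ‖V.a₃‖ * _ ≤ 1 * (‖x‖ * ‖y‖) := mul_le_mul h₃ hin (norm_nonneg _) zero_le_one
      _ = ‖x‖ * ‖y‖ := one_mul _
  · rw [norm_mul, norm_mul]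
    calc ‖V.a₄‖ * ‖x‖ * ‖y‖ ≤ 1 * ‖x‖ * ‖y‖ := by gcongr
      _ = ‖x‖ * ‖y‖ := by ring
  · rw [norm_mul]
    calc ‖V.a₆‖ * ‖y‖ ≤ 1 * ‖y‖ := by gcongr
      _ = ‖y‖ := one_mul _
      _ ≤ ‖x‖ * ‖y‖ := hyxy

/-! ### §2 The formal logarithm to fourth order, RELATIVE error `‖z‖⁵` -/

section FormalLog

variable (V : WeierstrassCurve ℚ_[3]) [V.IsIntegral ℤ_[3]]

/-- `‖1/(n+5)‖₃ ≤ 3ⁿ` (`5` unit, `‖1/6‖ = 3`, and `n + 5 ≤ 3ⁿ` for `n ≥ 2`). [folklore] -/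
private theorem norm_inv_natCast_add_five_le' (n : ℕ) : ‖(((n + 5 : ℕ) : ℚ_[3]))⁻¹‖ ≤ (3 : ℝ) ^ n := by
  rcases Nat.lt_or_ge n 2 with hn | hn
  · interval_cases n
    · have : ‖(((0 + 5 : ℕ) : ℚ_[3]))⁻¹‖ = 1 := by
        rw [norm_inv, Padic.norm_eq_zpow_neg_valuation (by norm_num), Padic.valuation_natCast,
          padicValNat.eq_zero_of_not_dvd (by norm_num)]; simp
      rw [this]; norm_num
    · have : ‖(((1 + 5 : ℕ) : ℚ_[3]))⁻¹‖ = 3 := by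
        rw [show ((1 + 5 : ℕ) : ℚ_[3]) = ((2 : ℕ) : ℚ_[3]) * (3 : ℕ) by norm_num, mul_inv, norm_mul,
          norm_inv, norm_inv, Padic.norm_natCast_eq_one_iff.mpr (by decide), Padic.norm_p]; norm_num
      rw [this]; norm_num
  · have hm : ‖(((n + 5 : ℕ) : ℚ_[3]))⁻¹‖ ≤ ((n + 5 : ℕ) : ℝ) := padic_norm_inv_natCast_le (n + 5)
    refine hm.trans ?_
    have key : ∀ k : ℕ, ((k + 2 + 5 : ℕ) : ℝ) ≤ (3 : ℝ) ^ (k + 2) := by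
      intro k
      induction k with
      | zero => norm_num
      | succ j ih =>
        have : ((j + 1 + 2 + 5 : ℕ) : ℝ) = ((j + 2 + 5 : ℕ) : ℝ) + 1 := by push_cast; ring
        rw [this, show j + 1 + 2 = (j + 2) + 1 by ring, pow_succ]
        nlinarith [ih, show (1 : ℝ) ≤ (3 : ℝ) ^ (j + 2) from one_le_pow₀ (by norm_num)]
    obtain ⟨k, rfl⟩ : ∃ k, n = k + 2 := ⟨n - 2, by omega⟩
    exact key k

/-- The terms of degree `n + 5` of `log_W(z)` have norm `≤ ‖z‖⁵` when `‖z‖₃ ≤ 3⁻¹`.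
[cite: SilvermanAEC2009, IV.6.3] -/
private theorem norm_formalLog_term_le_pow_five {z : ℚ_[3]} (hz : ‖z‖ ≤ 1 / 3) (n : ℕ) :
    ‖coeff (n + 5) V.formalLog * z ^ (n + 5)‖ ≤ ‖z‖ ^ 5 := by
  rw [norm_mul, norm_pow]
  have hc := Rung62310y1.norm_coeff_formalLog_le_norm_inv V (n + 3)
  rw [show n + 3 + 2 = n + 5 by ring] at hc
  have hz0 : 0 ≤ ‖z‖ := norm_nonneg z
  calc ‖coeff (n + 5) V.formalLog‖ * ‖z‖ ^ (n + 5) ≤ (3 : ℝ) ^ n * ‖z‖ ^ (n + 5) := by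
        gcongr; exact hc.trans (norm_inv_natCast_add_five_le' n)
    _ = ((3 : ℝ) ^ n * ‖z‖ ^ n) * ‖z‖ ^ 5 := by ring
    _ ≤ ((3 : ℝ) ^ n * (1 / 3 : ℝ) ^ n) * ‖z‖ ^ 5 := by gcongr
    _ = ‖z‖ ^ 5 := by rw [← mul_pow]; norm_num

/-- **`log_W(z) = z + ½a₁z² + ⅓(a₁²+a₂)z³ + ¼(a₁³+2a₁a₂+2a₃)z⁴ + O(‖z‖⁵)` on `‖z‖₃ ≤ 3⁻¹`** for a
`3`-integral equation over `ℚ₃` — the relative form of lane A's `KernelCert.norm_padicFormalLog_sub_quartic_le`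
(absolute error `3⁻⁵` there). [cite: SilvermanAEC2009, IV.5.5, IV.6.4] -/
theorem norm_padicFormalLog_sub_quartic_le_pow_five {z : ℚ_[3]} (hz : ‖z‖ ≤ 1 / 3) :
    ‖V.padicFormalLog z - (z + (2 : ℚ_[3])⁻¹ * V.a₁ * z ^ 2 + (3 : ℚ_[3])⁻¹ * (V.a₁ ^ 2 + V.a₂) * z ^ 3 +
      (4 : ℚ_[3])⁻¹ * (V.a₁ ^ 3 + 2 * V.a₁ * V.a₂ + 2 * V.a₃) * z ^ 4)‖ ≤ ‖z‖ ^ 5 := by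
  have hs := V.summable_formalLog_of_isIntegral z (hz.trans_lt (by norm_num))
  have hsplit := hs.sum_add_tsum_nat_add 5
  have h0 : coeff 0 V.formalLog = 0 := by rw [coeff_zero_eq_constantCoeff]; exact V.constantCoeff_formalLog
  have h2 : coeff 2 V.formalLog = (2 : ℚ_[3])⁻¹ * V.a₁ := by
    rw [(Rung62310y1.coeff_two_formalLog V), eq_ratCast]; push_cast; ring
  have h3 : coeff 3 V.formalLog = (3 : ℚ_[3])⁻¹ * (V.a₁ ^ 2 + V.a₂) := by
    rw [(Rung62310y1.coeff_three_formalLog V), eq_ratCast]; push_cast; ring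
  have h4 : coeff 4 V.formalLog = (4 : ℚ_[3])⁻¹ * (V.a₁ ^ 3 + 2 * V.a₁ * V.a₂ + 2 * V.a₃) := by
    rw [(KernelCert.coeff_four_formalLog V), eq_ratCast]; push_cast; ring
  have hfive : ∑ i ∈ Finset.range 5, coeff i V.formalLog * z ^ i =
      z + (2 : ℚ_[3])⁻¹ * V.a₁ * z ^ 2 + (3 : ℚ_[3])⁻¹ * (V.a₁ ^ 2 + V.a₂) * z ^ 3 +
        (4 : ℚ_[3])⁻¹ * (V.a₁ ^ 3 + 2 * V.a₁ * V.a₂ + 2 * V.a₃) * z ^ 4 := by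
    simp only [Finset.sum_range_succ, Finset.sum_range_zero, h0, V.coeff_one_formalLog, h2, h3, h4]
    ring
  rw [WeierstrassCurve.padicFormalLog, ← hsplit, hfive, add_sub_cancel_left]
  exact IsUltrametricDist.norm_tsum_le_of_forall_le_of_nonneg (by positivity) fun n ↦
    norm_formalLog_term_le_pow_five V hz n

end FormalLog

/-! ### §3 The Iwasawa logarithm near `1` to second order: `log₃(1+u) = u − u²/2 + O(3‖u‖³)` -/

/-- `‖1/m‖₃ ≤ 3^{m−2}` for `m ≥ 2` (`v₃(m) ≤ m − 2`). [folklore] -/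
private theorem norm_inv_natCast_le_three_pow {m : ℕ} (hm : 2 ≤ m) :
    ‖((m : ℚ_[3]))⁻¹‖ ≤ (3 : ℝ) ^ (m - 2) := by
  have hm0 : (m : ℚ_[3]) ≠ 0 := by exact_mod_cast (show m ≠ 0 by omega)
  rw [norm_inv_eq_zpow_valuation hm0, Padic.valuation_natCast, zpow_natCast]
  have hv := padicValNat_add_two_le (p := 3) hm
  rw [padicValNat.eq_zero_of_not_dvd (show ¬ 3 ∣ 2 by norm_num)] at hv
  exact_mod_cast Nat.pow_le_pow_right (by norm_num) (by omega)

/-- **`‖log₃(1 + u) − (u − u²/2)‖₃ ≤ 3‖u‖₃³` for `‖u‖₃ ≤ 3⁻¹`**: the logarithmic series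
`log₃(1+u) = u − u²/2 + u³/3 − …` (Iwasawa; `padicLog_eq_padicLogSeries`) with every term `uᵐ/m`,
`m ≥ 3`, of norm `≤ 3^{m−2}‖u‖ᵐ ≤ 3‖u‖³` (as `3‖u‖ ≤ 1`). The second-order companion of the tree's
`norm_padicLog_one_add_sub_le` (`‖log(1+u) − u‖ ≤ ‖u‖²`). [cite: Iwasawa1972PadicL, §4.4] -/
theorem norm_padicLog_one_add_sub_sub_le {u : ℚ_[3]} (hu : ‖u‖ ≤ 1 / 3) :
    ‖padicLog 3 (1 + u) - (u - u ^ 2 / 2)‖ ≤ 3 * ‖u‖ ^ 3 := by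
  have hu1 : ‖u‖ < 1 := hu.trans_lt (by norm_num)
  have h1y : ‖1 - (1 + u)‖ < 1 := by rwa [sub_add_cancel_left, norm_neg]
  rw [padicLog_eq_padicLogSeries h1y]
  have ht : ‖-u‖ < 1 := by rwa [norm_neg]
  have hsum := summable_padicLogSeries_term (p := 3) ht
  -- split off the first two terms `u − u²/2`
  have hser : padicLogSeries 3 (1 + u) = ∑' n : ℕ, -((-u) ^ (n + 1)) / (n + 1 : ℚ_[3]) := by
    rw [padicLogSeries, sub_add_cancel_left]
  have hsplit := hsum.sum_add_tsum_nat_add 2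
  have htwo : ∑ i ∈ Finset.range 2, -((-u) ^ (i + 1)) / ((i : ℚ_[3]) + 1) = u - u ^ 2 / 2 := by
    simp only [Finset.sum_range_succ, Finset.sum_range_zero]
    norm_num
    ring
  rw [hser, ← hsplit, htwo, add_sub_cancel_left]
  refine norm_tsum_le_of_forall_le_of_nonneg (by positivity) fun n ↦ ?_
  have hm : 2 ≤ n + 3 := by omega
  have e : -((-u) ^ (n + 2 + 1)) / (((n + 2 : ℕ) : ℚ_[3]) + 1) = -((-u) ^ (n + 3)) / ((n + 3 : ℕ) : ℚ_[3]) := by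
    push_cast; ring_nf
  rw [e, norm_div, norm_neg, norm_pow, norm_neg, div_eq_mul_inv, ← norm_inv]
  have h3u : 3 * ‖u‖ ≤ 1 := by linarith
  have hu0 : 0 ≤ ‖u‖ := norm_nonneg u
  calc ‖u‖ ^ (n + 3) * ‖(((n + 3 : ℕ) : ℚ_[3]))⁻¹‖ ≤ ‖u‖ ^ (n + 3) * (3 : ℝ) ^ (n + 3 - 2) :=
        by gcongr; exact norm_inv_natCast_le_three_pow (by omega)
    _ = 3 * ‖u‖ ^ 3 * (3 * ‖u‖) ^ n := by rw [show n + 3 - 2 = n + 1 from rfl]; ring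
    _ ≤ 3 * ‖u‖ ^ 3 * 1 ^ n := by gcongr
    _ = 3 * ‖u‖ ^ 3 := by ring

/-! ### §4 The scale to the depth of `q`: `C⁻² ≡ −c₆/c₄ (mod 3·q)` -/

section Scale

variable {W : WeierstrassCurve ℚ}

/-- **`‖C⁻² + c₆/c₄‖₃ ≤ 3⁻¹‖q‖₃`** at a multiplicative `3` (`‖q‖₃ < 1`): with
`C² = c₆(E_q)c₄(W)/(c₄(E_q)c₆(W))`, `C⁻² + c₆/c₄ = c₆(W)·(c₄(E_q) + c₆(E_q))/(c₆(E_q)c₄(W))` and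
`c₄(E_q) + c₆(E_q) = 240·s₃(q) + 504·s₅(q)` has norm `≤ 3⁻¹‖q‖`. So the uniformisation scale — the one
transcendental datum in the `z²`-coefficient of `x·Σ²` — agrees with the RATIONAL `−c₆/c₄` of the minimal
model to `v₃(q) + 1 = v₃(Δ) + 1` digits: the Kodaira type `I_ν` fixes the precision of the closed form.
[cite: SilvermanATAEC1994, Thm. V.3.1 (b)] [cite: SilvermanAEC2009, VII.5.1] -/
theorem norm_inv_scaleSq_add_c₆_div_c₄_le [W.IsElliptic] [W.IsGloballyMinimal] (hW : Mult W 3)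
    {q : ℚ_[3]} (hq : ‖q‖ < 1) :
    ‖(uniformisationScaleSq W 3 q)⁻¹ + (W.baseChange ℚ_[3]).c₆ / (W.baseChange ℚ_[3]).c₄‖ ≤ 3⁻¹ * ‖q‖ := by
  set V := W.baseChange ℚ_[3] with hVdef
  obtain ⟨hc4W, hc6W⟩ := norm_c₄_c₆_baseChange_eq_one (W := W) hW
  have h12 : (12 : ℚ_[3]) ≠ 0 := by norm_num
  have hq1 : ‖q‖ ≤ 1 := hq.le
  have hc4q : (tateCurve q).c₄ = 1 + 240 * tateS 3 q := by rw [tateCurve_c₄, tateE4_eq]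
  have hc6q : (tateCurve q).c₆ = -(1 - 504 * tateS 5 q) := by rw [tateCurve_c₆ h12, tateE6]
  have hS3 : ‖tateS 3 q‖ ≤ ‖q‖ := norm_tateS_le hq1
  have hS5 : ‖tateS 5 q‖ ≤ ‖q‖ := norm_tateS_le hq1
  have h3n : ‖(3 : ℚ_[3])‖ = 1 / 3 := by
    rw [show (3 : ℚ_[3]) = ((3 : ℕ) : ℚ_[3]) by norm_cast, Padic.norm_p]; norm_num
  have h240 : ‖(240 : ℚ_[3])‖ ≤ 1 / 3 := by
    rw [show (240 : ℚ_[3]) = ((80 : ℤ) : ℚ_[3]) * 3 by norm_num, norm_mul, h3n]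
    calc ‖((80 : ℤ) : ℚ_[3])‖ * (1 / 3) ≤ 1 * (1 / 3) := by gcongr; exact Padic.norm_int_le_one 80
      _ = 1 / 3 := one_mul _
  have h504 : ‖(504 : ℚ_[3])‖ ≤ 1 / 3 := by
    rw [show (504 : ℚ_[3]) = ((168 : ℤ) : ℚ_[3]) * 3 by norm_num, norm_mul, h3n]
    calc ‖((168 : ℤ) : ℚ_[3])‖ * (1 / 3) ≤ 1 * (1 / 3) := by gcongr; exact Padic.norm_int_le_one 168
      _ = 1 / 3 := one_mul _
  have hc6q1 : ‖(tateCurve q).c₆‖ = 1 := norm_c₆_tateCurve_eq_one hq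
  have hden : ‖(tateCurve q).c₆ * V.c₄‖ = 1 := by rw [norm_mul, hc6q1, hc4W, one_mul]
  have hden0 : (tateCurve q).c₆ * V.c₄ ≠ 0 := norm_pos_iff.mp (by rw [hden]; exact one_pos)
  have hc4W0 : V.c₄ ≠ 0 := norm_pos_iff.mp (by rw [hc4W]; exact one_pos)
  have hc6q0 : (tateCurve q).c₆ ≠ 0 := norm_pos_iff.mp (by rw [hc6q1]; exact one_pos)
  have hCdef : uniformisationScaleSq W 3 q = (tateCurve q).c₆ * V.c₄ / ((tateCurve q).c₄ * V.c₆) := rfl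
  have e : (uniformisationScaleSq W 3 q)⁻¹ + V.c₆ / V.c₄ =
      V.c₆ * ((tateCurve q).c₄ + (tateCurve q).c₆) / ((tateCurve q).c₆ * V.c₄) := by
    rw [hCdef, inv_div, eq_div_iff hden0]
    field_simp
  rw [e, norm_div, hden, div_one, norm_mul, hc6W, one_mul, hc4q, hc6q,
    show 1 + 240 * tateS 3 q + -(1 - 504 * tateS 5 q) = 240 * tateS 3 q + 504 * tateS 5 q by ring]
  refine (norm_add_le_max _ _).trans (max_le ?_ ?_)
  · rw [norm_mul]
    calc ‖(240 : ℚ_[3])‖ * ‖tateS 3 q‖ ≤ (1 / 3) * ‖q‖ := by gcongr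
      _ = 3⁻¹ * ‖q‖ := by norm_num
  · rw [norm_mul]
    calc ‖(504 : ℚ_[3])‖ * ‖tateS 5 q‖ ≤ (1 / 3) * ‖q‖ := by gcongr
      _ = 3⁻¹ * ‖q‖ := by norm_num

/-- **`κ ≡ (18b₆ − b₂b₄)/c₄ (mod q)`**: the `z²`-coefficient `κ = (C⁻² − b₂)/12` of `x·Σ²_E` differs from the
RATIONAL constant `(18b₆ − b₂b₄)/c₄ = (−c₆/c₄ − b₂)/12` of the minimal model by at most `‖q‖₃` (`‖1/12‖₃ = 3`
times `3⁻¹‖q‖`): the second digit of the «finite case table» (part 1: `κ ≡ −b₂b₄/c₄ mod 3`) refined to the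
depth of the Tate parameter. [cite: SilvermanATAEC1994, Thm. V.3.1 (b)] -/
theorem norm_kappa_sub_rational_le [W.IsElliptic] [W.IsGloballyMinimal] (hW : Mult W 3) {q : ℚ_[3]}
    (hq : ‖q‖ < 1) :
    ‖((uniformisationScaleSq W 3 q)⁻¹ - (W.baseChange ℚ_[3]).b₂) / 12 -
        (18 * (W.baseChange ℚ_[3]).b₆ - (W.baseChange ℚ_[3]).b₂ * (W.baseChange ℚ_[3]).b₄) /
          (W.baseChange ℚ_[3]).c₄‖ ≤ ‖q‖ := by
  set V := W.baseChange ℚ_[3] with hVdef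
  obtain ⟨hc4W, -⟩ := norm_c₄_c₆_baseChange_eq_one (W := W) hW
  have hc4W0 : V.c₄ ≠ 0 := norm_pos_iff.mp (by rw [hc4W]; exact one_pos)
  have h12i : ‖(12 : ℚ_[3])⁻¹‖ = 3 := by
    have h4n : ‖(4 : ℚ_[3])‖ = 1 := by
      simpa using Padic.norm_natCast_eq_one_iff.mpr (show Nat.Coprime 3 4 by decide)
    rw [show (12 : ℚ_[3]) = 4 * 3 by norm_num, mul_inv, norm_mul, norm_inv, norm_inv, h4n,
      show (3 : ℚ_[3]) = ((3 : ℕ) : ℚ_[3]) by norm_cast, Padic.norm_p]; norm_num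
  have hc4b : V.c₄ = V.b₂ ^ 2 - 24 * V.b₄ := rfl
  have hc6b : V.c₆ = -V.b₂ ^ 3 + 36 * V.b₂ * V.b₄ - 216 * V.b₆ := rfl
  have e : ((uniformisationScaleSq W 3 q)⁻¹ - V.b₂) / 12 - (18 * V.b₆ - V.b₂ * V.b₄) / V.c₄ =
      (12 : ℚ_[3])⁻¹ * ((uniformisationScaleSq W 3 q)⁻¹ + V.c₆ / V.c₄) := by
    field_simp
    rw [hc6b, hc4b]
    ring
  rw [e, norm_mul, h12i]
  calc 3 * ‖(uniformisationScaleSq W 3 q)⁻¹ + V.c₆ / V.c₄‖ ≤ 3 * (3⁻¹ * ‖q‖) := by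
        gcongr; exact norm_inv_scaleSq_add_c₆_div_c₄_le hW hq
    _ = ‖q‖ := by ring

end Scale

end Summit.BirchSwinnertonDyer.Rank1Residual.X11b.RegMult.HeightLogNumerator

end
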